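import Summits.CriticalPhenomena.PercolationContinuityZ3.Theorems.PercNearOneGluingNoHeavyLowerTailOneCutFourBlobs
import HarnessLib

/-!
# `NoHeavyLowerTail` (stmt-CriticalPhenomena-4575) — calibration: the cumulative isolation lemma at the
# HALF level already contains EVENT GLUING (the strong event form of `AdditiveGluing`, crux 4576)

Support file (depth prover nh-dp-blobmono gen 2, blob-quotient line; `--supports stmt-CriticalPhenomena-4575`).
No definitions, no named facts, no sorries.

The lead's typed engine is the cumulative isolation lemma; its reduction
`Theorems.noHeavyLowerTail_of_cumulativeIsolation` consumes exactly the HALF-LEVEL family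

  `CIL_half : ∀ n w A o, A.Nonempty → o ∉ A → ∃ a ∈ A, μ{1 ≤ N ∧ 2N ≤ |A|} ≤ μ{2|π(a)| ≤ |A|}`

(`N = |{x ∈ A : o ↔ x}|`, `π(a) = {x ∈ A : a ↔ x}`).  THIS FILE: apply `CIL_half` to the blob structure
"`k` singleton relays `A'` + one glued block `D ∋ d` of `k + 1` relays" (`A = A' ∪ D`, `|A| = 2k+1`).
On the good set (the block is a.s. connected) `2N ≤ |A|` forces `o ↮ d`, and `2|π(a)| ≤ |A|` forces
`a ∉ D` and `a ↮ d`; so the CIL conclusion is PRECISELY the event-gluing inequality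

  `EG_k :  μ({o ↮ d} ∩ ⋃_{a ∈ A'} {o ↔ a}) ≤ max_{a ∈ A'} μ{a ↮ d}`        (`eventGluing_of_cumulativeIsolationHalf`),

which in turn gives the additive form `μ(o ↔ A') − t ≤ μ(o ↔ d)` whenever `μ(a ↔ d) ≥ 1 − t` on `A'`
(`additiveGluing_glued_of_cumulativeIsolationHalf`) — the statement of the crux `AdditiveGluing`
(stmt-CriticalPhenomena-4576) for this graph.  Since every weighted graph embeds into one carrying such a
block (hang `k + 1` new vertices on `d` by weight-`1` edges; connection probabilities among the old vertices
are unchanged — this vertex-extension transfer is NOT formalised here), the engine as typed is at least as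
strong as the event form of Kozma–Nitzan's additive conjecture for EVERY `|A'|`: the two cruxes of the route
are nested, and the blob line's residual `EG_k` (gen 0, `oneCut_of_blobs_majority_of_eventGluing`) is an
instance of the lead's engine, not an independent input.  For `k = 2` the inequality `EG_2` is the landed
`lonelyOrPair_le_max` (C⁺); for `k = 3` it is the open three-relay E-form attacked by the 4576 seats.
-/

noncomputable section

namespace Summit.CriticalPhenomena.PercolationContinuityZ3.Theorems

open MeasureTheory Set Literature.Probability.LatticeModels Literature.Probability.Percolation
open scoped Classical BigOperators

variable {n : ℕ}

namespace CILEventGluing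

/-- A block with pairwise-null disconnections is a.s. connected: the bad set is null. [folklore] -/
theorem glued_compl_null (w : Sym2 (Fin n) → unitInterval) (D : Finset (Fin n)) {d : Fin n} (hd : d ∈ D)
    (hglue : ∀ u ∈ D, ∀ v ∈ D, (prodBernoulli w).real (openConn u v : Set (BondConfig (Fin n)))ᶜ = 0) :
    (prodBernoulli w).real {ω : BondConfig (Fin n) | ∀ u ∈ D, ∀ v ∈ D, (openGraph ω).Reachable u v}ᶜ = 0 := by
  have key := blobs_goodSet_compl_null w D d (fun _ => (0 : Fin 1)) (by
    intro u hu v hv _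
    rw [Finset.insert_eq_of_mem hd] at hu hv
    exact hglue u hu v hv)
  rw [Finset.insert_eq_of_mem hd] at key
  have hset : {ω : BondConfig (Fin n) | ∀ u ∈ D, ∀ v ∈ D, (openGraph ω).Reachable u v} =
      {ω : BondConfig (Fin n) | ∀ u ∈ D, ∀ v ∈ D,
        (fun _ => (0 : Fin 1)) u = (fun _ => (0 : Fin 1)) v → (openGraph ω).Reachable u v} := by
    ext ω
    simp only [mem_setOf_eq, forall_const]
  rw [hset]
  exact key

/-- Trapping through the a.s.-connected block: if `B ∩ {D connected} ⊆ E` then `μ B ≤ μ E`. [folklore] -/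
theorem real_le_of_inter_glued (w : Sym2 (Fin n) → unitInterval) (D : Finset (Fin n)) {d : Fin n}
    (hd : d ∈ D)
    (hglue : ∀ u ∈ D, ∀ v ∈ D, (prodBernoulli w).real (openConn u v : Set (BondConfig (Fin n)))ᶜ = 0)
    (B E : Set (BondConfig (Fin n)))
    (hBE : B ∩ {ω : BondConfig (Fin n) | ∀ u ∈ D, ∀ v ∈ D, (openGraph ω).Reachable u v} ⊆ E) :
    (prodBernoulli w).real B ≤ (prodBernoulli w).real E := by
  set μ := prodBernoulli w with hμ
  set G := {ω : BondConfig (Fin n) | ∀ u ∈ D, ∀ v ∈ D, (openGraph ω).Reachable u v} with hG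
  have hGc : μ.real Gᶜ = 0 := glued_compl_null w D hd hglue
  calc μ.real B ≤ μ.real (B ∩ G ∪ Gᶜ) := measureReal_mono fun ω hω => by
          by_cases hωG : ω ∈ G
          · exact Or.inl ⟨hω, hωG⟩
          · exact Or.inr hωG
    _ ≤ μ.real (B ∩ G) + μ.real Gᶜ := measureReal_union_le _ _
    _ ≤ μ.real E := by rw [hGc, add_zero]; exact measureReal_mono hBE

end CILEventGluing

open CILEventGluing

/-- **CIL at the half level ⇒ event gluing `EG_k` (every `k`), on graphs carrying a glued block.**
Hypothesis: the half-level cumulative isolation lemma, verbatim as consumed by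
`Theorems.noHeavyLowerTail_of_cumulativeIsolation`.  Conclusion: for singleton relays `A'` (nonempty),
an observer `o` and a sink `d` lying in a block `D` of `|A'| + 1` vertices that is a.s. connected and
disjoint from `A'` and `o`, some `a ∈ A'` has `μ({o ↮ d} ∩ ⋃_{x ∈ A'} {o ↔ x}) ≤ μ{a ↮ d}`.
Proof: CIL_half for `A = A' ∪ D` (`|A| = 2|A'| + 1`); on the good set `{1 ≤ N, 2N ≤ |A|} ⊇
{o ↮ d} ∩ {o ↔ A'}` and `{2|π(a)| ≤ |A|} ⊆ {a ↮ d}` for `a ∈ A'`, `= ∅` for `a ∈ D`. [folklore] -/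
theorem eventGluing_of_cumulativeIsolationHalf
    (hCIL : ∀ (n : ℕ) (w : Sym2 (Fin n) → unitInterval) (A : Finset (Fin n)) (o : Fin n),
      A.Nonempty → o ∉ A → ∃ a ∈ A,
        (prodBernoulli w).real {ω : BondConfig (Fin n) |
            1 ≤ (A.filter fun x => ω ∈ openConn o x).card ∧
              2 * (A.filter fun x => ω ∈ openConn o x).card ≤ A.card} ≤
          (prodBernoulli w).real {ω : BondConfig (Fin n) |
            2 * (A.filter fun x => ω ∈ openConn a x).card ≤ A.card})
    (w : Sym2 (Fin n) → unitInterval) (A' D : Finset (Fin n)) (o d : Fin n)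
    (hd : d ∈ D) (hcard : D.card = A'.card + 1) (hdisj : Disjoint A' D) (hoA : o ∉ A') (hoD : o ∉ D)
    (hglue : ∀ u ∈ D, ∀ v ∈ D, (prodBernoulli w).real (openConn u v : Set (BondConfig (Fin n)))ᶜ = 0)
    (hA' : A'.Nonempty) :
    ∃ a ∈ A', (prodBernoulli w).real ((openConn o d : Set (BondConfig (Fin n)))ᶜ ∩ ⋃ x ∈ A', openConn o x) ≤
      (prodBernoulli w).real (openConn a d : Set (BondConfig (Fin n)))ᶜ := by
  set μ := prodBernoulli w with hμ
  set A := A' ∪ D with hA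
  set G := {ω : BondConfig (Fin n) | ∀ u ∈ D, ∀ v ∈ D, (openGraph ω).Reachable u v} with hG
  have hAcard : A.card = 2 * A'.card + 1 := by
    rw [hA, Finset.card_union_of_disjoint hdisj, hcard]; ring
  have hAne : A.Nonempty := by
    obtain ⟨a, ha⟩ := hA'
    exact ⟨a, Finset.mem_union_left _ ha⟩
  have hoA' : o ∉ A := by
    rw [hA, Finset.mem_union, not_or]; exact ⟨hoA, hoD⟩
  obtain ⟨a, haA, hle⟩ := hCIL n w A o hAne hoA'
  set L := {ω : BondConfig (Fin n) | 1 ≤ (A.filter fun x => ω ∈ openConn o x).card ∧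
      2 * (A.filter fun x => ω ∈ openConn o x).card ≤ A.card} with hL
  set R := {ω : BondConfig (Fin n) | 2 * (A.filter fun x => ω ∈ openConn a x).card ≤ A.card} with hR
  set EG := (openConn o d : Set (BondConfig (Fin n)))ᶜ ∩ ⋃ x ∈ A', (openConn o x : Set (BondConfig (Fin n)))
    with hEG
  -- (1) the event-gluing event lies in the CIL minority event, on the good set
  have h1 : EG ∩ G ⊆ L := by
    rintro ω ⟨⟨hod, hoU⟩, hωG⟩
    obtain ⟨x, hx, hox⟩ := mem_iUnion₂.1 hoU
    have hod' : ¬ (openGraph ω).Reachable o d := hod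
    -- the relays joined to `o` are contained in `A'`
    have hsub : (A.filter fun y => ω ∈ openConn o y) ⊆ A' := by
      intro y hy
      obtain ⟨hyA, hoy⟩ := Finset.mem_filter.1 hy
      rcases Finset.mem_union.1 hyA with hyA' | hyD
      · exact hyA'
      · have hoy' : (openGraph ω).Reachable o y := hoy
        exact absurd (hoy'.trans (hωG y hyD d hd)) hod'
    have hxin : x ∈ A.filter fun y => ω ∈ openConn o y :=
      Finset.mem_filter.2 ⟨Finset.mem_union_left _ hx, hox⟩
    refine ⟨Finset.card_pos.2 ⟨x, hxin⟩, ?_⟩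
    rw [hAcard]
    have := Finset.card_le_card hsub
    omega
  have hEGL : μ.real EG ≤ μ.real L := real_le_of_inter_glued w D hd hglue EG L h1
  rcases Finset.mem_union.1 haA with haA' | haD
  · -- (2) `a ∈ A'`: `{2|π(a)| ≤ |A|} ⊆ {a ↮ d}` on the good set
    refine ⟨a, haA', hEGL.trans (hle.trans ?_)⟩
    refine real_le_of_inter_glued w D hd hglue R _ ?_
    rintro ω ⟨hωR, hωG⟩ had
    have had' : (openGraph ω).Reachable a d := had
    have hsub : insert a D ⊆ A.filter fun y => ω ∈ openConn a y := by
      intro y hy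
      rcases Finset.mem_insert.1 hy with rfl | hyD
      · exact Finset.mem_filter.2 ⟨haA, (SimpleGraph.Reachable.refl _ : (openGraph ω).Reachable _ _)⟩
      · exact Finset.mem_filter.2 ⟨Finset.mem_union_right _ hyD, had'.trans (hωG d hd y hyD)⟩
    have haD : a ∉ D := Finset.disjoint_left.1 hdisj haA'
    have hc := Finset.card_le_card hsub
    rw [Finset.card_insert_of_notMem haD, hcard] at hc
    have hωR' : 2 * (A.filter fun y => ω ∈ openConn a y).card ≤ A.card := hωR
    rw [hAcard] at hωR'
    omega
  · -- (3) `a ∈ D`: `{2|π(a)| ≤ |A|}` is null, so `μ EG ≤ 0`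
    obtain ⟨a', ha'⟩ := hA'
    refine ⟨a', ha', hEGL.trans (hle.trans ?_)⟩
    have hR0 : μ.real R ≤ μ.real (∅ : Set (BondConfig (Fin n))) := by
      refine real_le_of_inter_glued w D hd hglue R ∅ ?_
      rintro ω ⟨hωR, hωG⟩
      have hsub : D ⊆ A.filter fun y => ω ∈ openConn a y := fun y hyD =>
        Finset.mem_filter.2 ⟨Finset.mem_union_right _ hyD, hωG a haD y hyD⟩
      have hc := Finset.card_le_card hsub
      have hωR' : 2 * (A.filter fun y => ω ∈ openConn a y).card ≤ A.card := hωR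
      rw [hAcard] at hωR'
      rw [hcard] at hc
      exact absurd hωR' (by omega)
    rw [measureReal_empty] at hR0
    exact hR0.trans measureReal_nonneg

/-- **CIL at the half level ⇒ the additive-gluing inequality of crux `AdditiveGluing`
(stmt-CriticalPhenomena-4576) on graphs carrying a glued block.**  With `A'`, `o`, `d ∈ D` as in
`eventGluing_of_cumulativeIsolationHalf` and a slack `t ≥ 0` with `1 − t ≤ μ{a ↔ d}` for all `a ∈ A'`:
`μ(⋃_{a ∈ A'} {o ↔ a}) − t ≤ μ{o ↔ d}` (for empty `A'` the left side is `−t ≤ 0`). [folklore] -/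
theorem additiveGluing_glued_of_cumulativeIsolationHalf
    (hCIL : ∀ (n : ℕ) (w : Sym2 (Fin n) → unitInterval) (A : Finset (Fin n)) (o : Fin n),
      A.Nonempty → o ∉ A → ∃ a ∈ A,
        (prodBernoulli w).real {ω : BondConfig (Fin n) |
            1 ≤ (A.filter fun x => ω ∈ openConn o x).card ∧
              2 * (A.filter fun x => ω ∈ openConn o x).card ≤ A.card} ≤
          (prodBernoulli w).real {ω : BondConfig (Fin n) |
            2 * (A.filter fun x => ω ∈ openConn a x).card ≤ A.card})
    (w : Sym2 (Fin n) → unitInterval) (A' D : Finset (Fin n)) (o d : Fin n)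
    (hd : d ∈ D) (hcard : D.card = A'.card + 1) (hdisj : Disjoint A' D) (hoA : o ∉ A') (hoD : o ∉ D)
    (hglue : ∀ u ∈ D, ∀ v ∈ D, (prodBernoulli w).real (openConn u v : Set (BondConfig (Fin n)))ᶜ = 0)
    (t : ℝ) (ht : 0 ≤ t)
    (hrel : ∀ a ∈ A', 1 - t ≤ (prodBernoulli w).real (openConn a d : Set (BondConfig (Fin n)))) :
    (prodBernoulli w).real (⋃ a ∈ A', (openConn o a : Set (BondConfig (Fin n)))) - t ≤
      (prodBernoulli w).real (openConn o d : Set (BondConfig (Fin n))) := by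
  set μ := prodBernoulli w with hμ
  haveI : IsProbabilityMeasure μ := by rw [hμ]; infer_instance
  by_cases hA' : A'.Nonempty
  · obtain ⟨a, ha, hle⟩ :=
      eventGluing_of_cumulativeIsolationHalf hCIL w A' D o d hd hcard hdisj hoA hoD hglue hA'
    -- `μ{a ↮ d} ≤ t`
    have hcut : μ.real (openConn a d : Set (BondConfig (Fin n)))ᶜ ≤ t := by
      have h := measureReal_compl (μ := μ) (s := (openConn a d : Set (BondConfig (Fin n))))
        MeasurableSet.of_discrete
      rw [probReal_univ] at h
      have := hrel a ha
      linarith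
    -- `μ(o ↔ A') ≤ μ(o ↔ d) + μ({o ↮ d} ∩ {o ↔ A'})`
    have hsplit : μ.real (⋃ x ∈ A', (openConn o x : Set (BondConfig (Fin n)))) ≤
        μ.real (openConn o d : Set (BondConfig (Fin n))) +
          μ.real ((openConn o d : Set (BondConfig (Fin n)))ᶜ ∩ ⋃ x ∈ A', openConn o x) := by
      calc μ.real (⋃ x ∈ A', (openConn o x : Set (BondConfig (Fin n))))
          ≤ μ.real ((openConn o d : Set (BondConfig (Fin n))) ∪
              ((openConn o d : Set (BondConfig (Fin n)))ᶜ ∩ ⋃ x ∈ A', openConn o x)) :=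
            measureReal_mono fun ω hω => by
              by_cases h : ω ∈ (openConn o d : Set (BondConfig (Fin n)))
              · exact Or.inl h
              · exact Or.inr ⟨h, hω⟩
        _ ≤ _ := measureReal_union_le _ _
    linarith
  · rw [Finset.not_nonempty_iff_eq_empty.1 hA']
    simp only [Finset.notMem_empty, iUnion_of_empty, iUnion_empty, measureReal_empty]
    linarith [measureReal_nonneg (μ := μ) (s := (openConn o d : Set (BondConfig (Fin n))))]

end Summit.CriticalPhenomena.PercolationContinuityZ3.Theorems

end
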